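import Summits.CriticalPhenomena.CardyFormulaZ2.Theorems.CardyComplexConeParafermionToSLESixFamiliesDiamondDefs
import Summits.CriticalPhenomena.CardyFormulaZ2.Theorems.CardyComplexConeParafermionToSLESixFamiliesFaceKernelUniformizers
import Summits.CriticalPhenomena.CardyFormulaZ2.Theorems.CardyComplexConeParafermionToSLESixFamiliesIicRectilinear
import HarnessLib

/-!
# Stub S6 `stub_identOnDiagRectilinear` of line `potential-darboux-picard-diamond` (crux `ParafermionToSLESixFamilies`, stmt-CriticalPhenomena-11389): the by-name reductions

Route `CardyComplexCone` (sub-problem `CriticalPhenomena/CardyFormulaZ2`), crux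
`Summit.CriticalPhenomena.CardyFormulaZ2.Theses.CardyComplexCone.ParafermionToSLESixFamilies`, line
`potential-darboux-picard-diamond` (skeleton `Cruxes/ParafermionToSLESixFamilies/Lines/potential_darboux_picard_diamond.lean`,
vocabulary `Theorems/…DiamondDefs.lean`). Stub S6 reads

  `(∀ D, IsDiagRectilinear D → DiagTouchLawPosPin D) → IdentOnDiagRectilinear`

(the slit-uniform pinned diagonal touch law on every all-diagonal polygon ⇒ every subsequential interface law
along an admissible family of such a polygon is the chordal SLE₆ law). It is the XL transport "Doob martingales of
the pinned touch functionals + Kemppainen–Smirnov + Loewner transport of the window density + `κ = 6` detector +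
Lévy"; this file does NOT prove it. It records, sorry-free and BY NAME, what the tree already reaches:

* §1 `identOnDiagRectilinear_of_slitMartingaleData`, `identOnDiagRectilinear_of_boxTight_of_paraApprox` — the
  CONCLUSION `IdentOnDiagRectilinear` follows from the caratheodory line's named data `SlitMartingaleData`
  (`isSLELaw_six_of_slitMartingaleData`, p127450), hence from the crux's two named research inputs
  `PercFaceBoxTight` (Kemppainen–Smirnov box tightness of the raw medial exploration) and `PercParaApprox` (bulk
  spin-`1/3` slit-observable martingale approximation) through `percKSBoxData_of_boxTight` (p129499) and
  `slitMartingaleData_of_percData` (p90407). The pinned touch law is NOT among the hypotheses: no named statement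
  of the tree lets it do work (see §3).
* §2 `limitData_of_boxTight`, `ae_isLoewnerDescribable_of_boxTight` — the (J′) half of the S6 endgame from
  `PercFaceBoxTight` ALONE: along an admissible family, every subsequential limit law `μ` of the interface
  functional `iface` is carried by curves from `a` that are `μ`-a.e. Loewner-describable through EVERY chordal
  uniformizing map `φ` of `(D; a, b)`, and the capacity driving processes of the discrete interfaces, read through
  the convergent uniformizers `φ_k → φ` of the oriented face domains (`exists_uniformizers_orientedFaceDomain`,
  p129601, unconditional), converge in distribution to the driving function of `μ`
  (`ae_isLoewnerDescribable_and_tendstoInDistribution_drivingPath_varying`, KS Thm 1.5 / Cor 1.7 in approximating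
  domains). This is the "Loewner describability of subsequential limits of the NON-SIMPLE medial polyline" listed
  as missing for the axis twin S6b (`Lines/iic-trace-flux-pairing-census.md`), reduced to the named box-tightness
  input.
* §3 (module docstring only, nothing declared) — what S6 proper still consumes beyond the tree, BY NAME or as a
  statement to be filed. (M1) `PercFaceBoxTight` itself (research: Condition G2 ⇒ box tightness for the RAW,
  self-touching medial polyline; the named fact `exists_regularity_of_conditionG2` is for simple curves).
  (M2) WINDOW-DENSITY TRANSPORT (deterministic, absent): on an active prefix the slit component `U_n` of the face
  domain `D_δ` is `φ_δ(H_θ)` for the Loewner chain `(g_θ, W)` of `φ_δ⁻¹ ∘ γ_δ` at the prefix's capacity `θ`, its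
  uniformizer normalised at (tip access, `b_δ`) is `φ_δ ∘ g_θ⁻¹(· + W_θ)`, so the pinned density of
  `HasPinTouchDensityAt` at a flat-side point `y′` IS `|(φ_δ⁻¹)′(y′)|^{1/3}|g_θ′(x′)|^{1/3}|g_θ(x′) − W_θ|^{-1/3}`,
  `x′ = φ_δ⁻¹(y′)` (conformal covariance + prime-end bookkeeping of `tipAccess`), and `|(φ_k⁻¹)′| → |ψ′|` on compact
  pieces of the open flat diagonal sides (Schwarz reflection; the face-domain side is parallel at distance `≤ δ`).
  (M3) BOUNDARY `κ = 6` DETECTOR (continuum, absent but clonable): `isSLELaw_six_of_limitData` /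
  `isSLELaw_six_of_paraCylinderIdentity` (`Literature/…/ParaObservableSLESix.lean`) with the bulk base point `I * y`
  replaced by a REAL boundary base point `x` beyond the hull and `cdhksTime y` by a boundary short-time horizon:
  the observable `(x g_t′(x)/(g_t(x) − W_t))^{1/3}` is `ρ_{D_t}(y)/ρ_D(y)` and has the same far field
  `1 + W_t/(3x) + ((2/9)W_t² − (4/3)t)/x² + O(x⁻³)` (`FarRegime` is stated for all far `z`), whence `W_t`,
  `W_t² − 6t`. (M4) ORIENTATION: the pinned law speaks of the G02 exploration `medialExploration (Λ δ)` (arc `A`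
  on its left), which for a counter-clockwise parametrised `D` runs from `b_δ` to `a_δ` (cf. the module docstring
  of `…IicTouchPin`, §4), while `iface` re-orients the curve to start at `a` (`ae_source_eq_of_isSubseqLimitLaw`);
  for those domains the touch martingales identify the law of the REVERSED limit curve as chordal SLE₆ from `b` to
  `a`, and `IsSLELaw 6 D μ` then consumes the reversibility in law of chordal SLE₆ — expressible by name as
  `∀ P : ChordalFamily, (∀ D, IsSLELaw 6 D (P D)) → P.IsReversible` (Miller–Sheffield, Ann. of Math. 184 (2016),
  Thm 1.1, `κ ∈ (4, 8)`), not in the tree — unless S6/S7 are restricted to the orientation in which the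
  exploration runs `a → b`. NOT a gap: the quantifier shape of `DiagTouchLawPosPin` (`∀ u, ∃ s c, ∀ g`) — the law
  may be re-applied to the extracted subsequence, so countably many windows accumulating at the target compose by
  diagonal extraction, and the window-dependent amplitudes `c > 0` divide out of each martingale `c ∫ g ρ_t`.

Sources: A. Kemppainen, S. Smirnov, Ann. Probab. 45 (2017), Thm 1.5 / Cor 1.7 / Cor 1.8; D. Chelkak et al.,
C. R. Math. 352 (2014), §3; H. Duminil-Copin, arXiv:1208.3787, Prop. 5 and p. 9; J. Miller, S. Sheffield,
Ann. of Math. 184 (2016), Thm 1.1.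
-/

noncomputable section

namespace Summit.CriticalPhenomena.CardyFormulaZ2.Cruxes.ParafermionToSLESixFamilies.PotentialDarbouxPicardDiamond

open scoped Topology NNReal ENNReal BoundedContinuousFunction
open Filter MeasureTheory Set Metric
open UpperHalfPlane (upperHalfPlaneSet)
open Literature.Probability Literature.Probability.LatticeModels Literature.Probability.Percolation
open Literature.Probability.RandomPlanarGeometry
open scoped Literature.Probability.RandomPlanarGeometry.PathBorel
open Summit.CriticalPhenomena.CardyFormulaZ2.Cruxes.ParafermionToSLESixFamilies.IicTraceFluxPairing
open Summit.CriticalPhenomena.CardyFormulaZ2.Cruxes.ParafermionToSLESixFamilies.FlipInvolutionReturnLaw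
  (IsDiagRectilinear IdentOnDiagRectilinear)
open Summit.CriticalPhenomena.CardyFormulaZ2.Cruxes.ParafermionToSLESixFamilies.CaratheodoryNetSlitUniformity
  (Pc SlitMartingaleData PercKSBoxData PercParaApprox PercFaceBoxTight isSLELaw_six_of_slitMartingaleData
    slitMartingaleData_of_percData ae_source_eq_of_tendsto_bondInterfaceIn)
open Summit.CriticalPhenomena.CardyFormulaZ2.Cruxes.ParafermionToSLESixFamilies.FaceKernel
  (percKSBoxData_of_boxTight exists_uniformizers_orientedFaceDomain)

/-! ## §1 The conclusion of S6 from the caratheodory line's named data -/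

/-- **`IdentOnDiagRectilinear` from `SlitMartingaleData`.** Along an admissible family of an all-diagonal
polygon (indeed of ANY Dobrushin domain — diagonal rectilinearity is not used), every subsequential limit law of
the interface functional is the chordal SLE₆ law, given the caratheodory line's slit-uniform martingale data:
`isSLELaw_six_of_slitMartingaleData` (Kemppainen–Smirnov describability + driving convergence + the bulk spin-`1/3`
martingale approximation, closed by the landed `κ = 6` step `stub_sleSixOfLimitData`). `iface D Λ δ` is
`bondInterfaceIn D (Λ δ)` and `perc δ` is `Pc` definitionally. -/
theorem identOnDiagRectilinear_of_slitMartingaleData : SlitMartingaleData → IdentOnDiagRectilinear := by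
  intro hData D _hD Λ hΛ μ hμ hsub
  exact isSLELaw_six_of_slitMartingaleData hData hΛ.zd hμ hsub

/-- **`IdentOnDiagRectilinear` from the crux's two named research inputs** `PercFaceBoxTight` (Kemppainen–Smirnov
box tightness of the raw, non-simple medial exploration polyline of bond-`ℤ²` families, read through the
uniformizers of the oriented face domains) and `PercParaApprox` (the bulk slit-observable martingale
approximation): `percKSBoxData_of_boxTight` ((K1) proved, line `face-kernel-k1`) and
`slitMartingaleData_of_percData`. The sharpest reduction of the CONCLUSION of S6 expressible with named statements
of the tree; the pinned touch law of S6's hypothesis is idle for it. -/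
theorem identOnDiagRectilinear_of_boxTight_of_paraApprox : PercFaceBoxTight → PercParaApprox → IdentOnDiagRectilinear :=
  fun h₁ h₂ => identOnDiagRectilinear_of_slitMartingaleData
    (slitMartingaleData_of_percData (percKSBoxData_of_boxTight h₁) h₂)

/-! ## §2 The (J′) half of the S6 endgame from box tightness alone -/

/-- **Kemppainen–Smirnov limit data of a subsequential interface law, from `PercFaceBoxTight`.** For an
admissible family `Λ` of `(D; a, b)`, a chordal uniformizing map `φ`, meshes `u n → 0⁺` and a probability
measure `μ` with `Law(iface D Λ (u n)) → μ` weakly: (i) `μ`-a.e. curve class is Loewner-describable through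
`φ`; (ii) `μ`-a.e. curve starts at `a`; (iii) after dropping finitely many meshes (`N`, so that the remaining
ones are positive and admissible) there are chordal uniformizing maps `φ_k` of the ORIENTED FACE DOMAINS of the
data `Λ (u (k + N))` whose boundary extensions converge to that of `φ` uniformly on the closed half-plane and
are uniformly close to the target `b_k` at infinity, through which the capacity driving processes of the
discrete interfaces converge in distribution, on `(BondConfig ℤ², P_{1/2})`, to the driving function of `μ`.
Proof: `exists_uniformizers_orientedFaceDomain` (Pommerenke's kernel theorem with (K1), (ULC), (B), (K2),
`a_k → a`, `b_k → b`, all proved), the box clause `PercFaceBoxTight` converted to the interface laws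
(`isClosed_image_and_continuousOn_drivingPath`, `isCompact_pairBox`), Kemppainen–Smirnov in approximating domains
(`ae_isLoewnerDescribable_and_tendstoInDistribution_drivingPath_varying`), transport to the lattice space
(`tendstoInDistribution_comp_of_map_eq`), and the source clause `ae_source_eq_of_tendsto_bondInterfaceIn`. -/
theorem limitData_of_boxTight (hBT : PercFaceBoxTight) {D : DobrushinDomain} {Λ : ℝ → DiscreteDobrushin}
    (hΛ : IsFamily D Λ) {φ : ConformalEquiv upperHalfPlaneSet D.carrier} (hφ : D.IsChordalUniformizing φ)
    {u : ℕ → ℝ} (hu : Tendsto u atTop (𝓝[>] (0:ℝ))) {μ : Measure (CurveClass ℂ)} [IsProbabilityMeasure μ]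
    (hlim : ∀ f : CurveClass ℂ →ᵇ ℝ,
      Tendsto (fun n => ∫ ω, f (iface D Λ (u n) ω) ∂(perc (u n))) atTop (𝓝 (∫ x, f x ∂μ))) :
    (∀ᵐ c ∂μ, IsLoewnerDescribable φ c) ∧ (∀ᵐ c ∂μ, c.source = D.pt 0) ∧
    ∃ (N : ℕ) (hadm : ∀ k, (Λ (u (k + N))).IsZdAdmissible)
      (φs : ∀ k, ConformalEquiv upperHalfPlaneSet (orientedFaceDomain hΛ.zd (hadm k)).carrier),
      (∀ k, 0 < u (k + N)) ∧
      (∀ k, (orientedFaceDomain hΛ.zd (hadm k)).IsChordalUniformizing (φs k)) ∧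
      TendstoUniformlyOn (fun k ↦ (φs k).boundaryExtension) φ.boundaryExtension atTop {z : ℂ | 0 ≤ z.im} ∧
      (∀ ε : ℝ, 0 < ε → ∃ r : ℝ, ∀ᶠ k in atTop, ∀ z : ℂ, z ∈ {z : ℂ | 0 ≤ z.im} → r ≤ ‖z‖ →
        dist ((φs k).boundaryExtension z) ((orientedFaceDomain hΛ.zd (hadm k)).pt 1) ≤ ε) ∧
      TendstoInDistribution
        (fun k ω ↦ (⟨fun t ↦ drivingFunction (φs k) (iface D Λ (u (k + N)) ω) t,
          continuous_drivingFunction (φs k) (iface D Λ (u (k + N)) ω)⟩ : C(ℝ≥0, ℝ)))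
        atTop (fun c ↦ (⟨drivingFunction φ c, continuous_drivingFunction φ c⟩ : C(ℝ≥0, ℝ)))
        (fun _ : ℕ => Pc) μ := by
  have hΛ' : ZdDiscretisationFamily D Λ := hΛ.zd
  -- the source clause
  have hsrc : ∀ᵐ c ∂μ, c.source = D.pt 0 := ae_source_eq_of_tendsto_bondInterfaceIn D Λ hΛ' u hu μ hlim
  -- drop the non-positive / non-admissible meshes
  have hpos : ∀ᶠ n in atTop, u n ∈ Ioi (0 : ℝ) := hu.eventually eventually_mem_nhdsWithin
  have hadm : ∀ᶠ n in atTop, (Λ (u n)).IsZdAdmissible := hu.eventually hΛ'.eventually_isZdAdmissible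
  obtain ⟨N, hN⟩ := (hpos.and hadm).exists_forall_of_atTop
  set δs : ℕ → ℝ := fun k ↦ u (k + N) with hδs
  have hδpos : ∀ k, 0 < δs k := fun k ↦ (hN _ (Nat.le_add_left _ _)).1
  have hδadm : ∀ k, (Λ (δs k)).IsZdAdmissible := fun k ↦ (hN _ (Nat.le_add_left _ _)).2
  have hδ0 : Tendsto δs atTop (𝓝 0) :=
    (tendsto_nhds_of_tendsto_nhdsWithin hu).comp (tendsto_add_atTop_nat N)
  -- the uniformizers of the oriented face domains (unconditional) and the box clause
  obtain ⟨φs, hφs, hU0, hU1, hU2⟩ :=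
    exists_uniformizers_orientedFaceDomain D Λ hΛ' φ hφ δs hδpos hδ0 hδadm
  have hbox := hBT D Λ hΛ' φ hφ δs hδpos hδ0 hδadm φs hφs hU1 hU2
  obtain ⟨-, hb⟩ := tendsto_pt_orientedFaceDomain hΛ' hδpos hδ0 hδadm
  -- the interface laws along `δs`
  set Ds : ℕ → DobrushinDomain := fun k ↦ orientedFaceDomain hΛ' (hδadm k) with hDsdef
  set Y : ∀ k : ℕ, BondConfig (Site 2) → CurveClass ℂ := fun k ↦ iface D Λ (δs k) with hYdef
  have hYm : ∀ k, AEMeasurable (Y k) Pc := fun k ↦ (measurable_bondInterfaceIn D _).aemeasurable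
  set μs : ℕ → Measure (CurveClass ℂ) := fun k ↦ Pc.map (Y k) with hμsdef
  haveI hμsP : ∀ k, IsProbabilityMeasure (μs k) := fun k ↦
    Measure.isProbabilityMeasure_map (hYm k)
  have hlim' : ∀ f : CurveClass ℂ →ᵇ ℝ,
      Tendsto (fun k ↦ ∫ c, f c ∂μs k) atTop (𝓝 (∫ c, f c ∂μ)) := by
    intro f
    have hint : ∀ k, ∫ c, f c ∂μs k = ∫ ω, f (Y k ω) ∂Pc := fun k ↦
      integral_map (hYm k) f.continuous.aestronglyMeasurable
    simp_rw [hint]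
    exact (hlim f).comp (tendsto_add_atTop_nat N)
  -- box tightness, in the form of laws
  have hbox' : ∀ ε : ℝ≥0∞, 0 < ε → ∃ (δγ δW : ℕ → ℝ) (T : ℕ → ℝ≥0), (∀ j, 0 < δγ j) ∧
      (∀ j, 0 < δW j) ∧
      ∀ k, μs k ((fun p ↦ compactifiedClass (φs k).boundaryExtension ((Ds k).pt 1) p.1) ''
        {p : C(ℝ≥0, ℂ) × C(ℝ≥0, ℝ) | p ∈ generatedPairs ∧
          p.1 ∈ Process.modulusSet ({0} : Set ℂ) δγ ∧ p.2 ∈ Process.modulusSet ({0} : Set ℝ) δW ∧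
          ∀ (j : ℕ) (t : ℝ≥0), T j ≤ t → (j : ℝ) ≤ ‖p.1 t‖})ᶜ ≤ ε := by
    intro ε hε
    obtain ⟨δγ, δW, T, hδγ, hδW, hall⟩ := hbox ε hε
    refine ⟨δγ, δW, T, hδγ, hδW, fun k ↦ ?_⟩
    set 𝒦 : Set (C(ℝ≥0, ℂ) × C(ℝ≥0, ℝ)) := {p | p ∈ generatedPairs ∧
      p.1 ∈ Process.modulusSet ({0} : Set ℂ) δγ ∧ p.2 ∈ Process.modulusSet ({0} : Set ℝ) δW ∧
      ∀ (j : ℕ) (t : ℝ≥0), T j ≤ t → (j : ℝ) ≤ ‖p.1 t‖} with h𝒦def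
    have h𝒦 : IsCompact 𝒦 := isCompact_pairBox hδγ hδW T
    have hgen : 𝒦 ⊆ generatedPairs := fun p hp ↦ hp.1
    have htrans : ∀ r : ℝ, ∃ T' : ℝ≥0, ∀ p ∈ 𝒦, ∀ t, T' ≤ t → r ≤ ‖p.1 t‖ := fun r ↦
      ⟨T ⌈r⌉₊, fun p hp t ht ↦ (Nat.le_ceil r).trans (hp.2.2.2 _ t ht)⟩
    have hclosed : IsClosed ((fun p ↦ compactifiedClass (φs k).boundaryExtension ((Ds k).pt 1)
        p.1) '' 𝒦) :=
      (isClosed_image_and_continuousOn_drivingPath (hφs k) h𝒦 hgen htrans).2.2.1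
    change (Pc.map (Y k)) _ ≤ ε
    rw [Measure.map_apply_of_aemeasurable (hYm k) hclosed.measurableSet.compl]
    exact hall k
  -- Kemppainen–Smirnov in approximating domains: describability and driving convergence
  obtain ⟨hdesc, hTD⟩ :=
    ae_isLoewnerDescribable_and_tendstoInDistribution_drivingPath_varying (Ds := Ds) hφ hφs hU1 hU2 hb
      hlim' hbox'
  -- transport of the driving-process convergence to the lattice probability space
  have hTD' := tendstoInDistribution_comp_of_map_eq (P := fun _ ↦ Pc) hTD Y hYm fun k ↦ rfl
  exact ⟨hdesc, hsrc, N, hδadm, φs, hδpos, hφs, hU0, hU2, hTD'⟩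

/-- **Loewner describability of every subsequential interface law, from `PercFaceBoxTight`** (the (J′) input of
the S6 endgame by name; registered helper of stub S6). Along an admissible family of any Dobrushin domain, every
probability measure that is a subsequential weak limit of the laws of the interface functional `iface` is
carried by curves from `a` that are a.e. Loewner-describable through every chordal uniformizing map of
`(D; a, b)` — Kemppainen–Smirnov's theorem (Thm 1.5 / Cor 1.7–1.8) for bond-`ℤ²` families, CONDITIONAL on the box
tightness of the raw (non-simple) medial exploration polyline, which the tree's named fact
`exists_regularity_of_conditionG2` (simple curves) does not supply. -/
theorem ae_isLoewnerDescribable_of_boxTight : PercFaceBoxTight → ∀ (D : DobrushinDomain) (Λ : ℝ → DiscreteDobrushin), IsFamily D Λ → ∀ μ : Measure (CurveClass ℂ), IsProbabilityMeasure μ → IsSubseqLimitLaw (iface D Λ) perc μ → ∀ φ : ConformalEquiv upperHalfPlaneSet D.carrier, D.IsChordalUniformizing φ → (∀ᵐ c ∂μ, IsLoewnerDescribable φ c) ∧ ∀ᵐ c ∂μ, c.source = D.pt 0 := by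
  intro hBT D Λ hΛ μ hμ hsub φ hφ
  haveI := hμ
  obtain ⟨u, hu, hlim⟩ := hsub
  obtain ⟨hdesc, hsrc, -⟩ := limitData_of_boxTight hBT hΛ hφ hu hlim
  exact ⟨hdesc, hsrc⟩

end Summit.CriticalPhenomena.CardyFormulaZ2.Cruxes.ParafermionToSLESixFamilies.PotentialDarbouxPicardDiamond

end
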